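import Summits.AtomisticToContinuum.Crystallization.Theorems.FrustratedLawDichotomyTwoShellRigidityLsLedgerFrame

/-!
# FrustratedLawDichotomy · TwoShellRigidity · the ls re-gauging LEDGER, part B (§4, section Ledger) (lens-3 g34 node d77bada9, split for the ≤ 400-line rule; critic row 662 (B)(2))

§4 — the configuration-free re-gauging ledger: `lsRot`, the gauge equation, bootstrap and residual bookkeeping.  Same namespace as parts A–D (`…FrustratedLawDichotomyTwoShellRigidityLsLedger`); bodies byte-identical to the node; the node's full
module documentation is in part A (`…LsLedgerFrame`).
-/

noncomputable section

namespace Summit.AtomisticToContinuum.Crystallization.Theorems.FrustratedLawDichotomyTwoShellRigidityLsLedger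

open Literature.Geometry.DiscreteGeometry
open Summit.AtomisticToContinuum.Crystallization.Theorems.FrustratedLawDichotomyTwoShellRigidityCut
open Summit.AtomisticToContinuum.Crystallization.Theorems.FrustratedLawDichotomyTwoShellRigidityCells
open Summit.AtomisticToContinuum.Crystallization.Theorems.FrustratedLawDichotomyTwoShellRigidityGaugedLadder
open Summit.AtomisticToContinuum.Crystallization.Theorems.FrustratedLawDichotomyTwoShellRigidityLsEntry
open scoped RealInnerProductSpace

/-! ## §4 The re-gauging LEDGER (configuration-free): the gauge equation identifies the rotation; bootstrap; residual bounds -/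

/-- **The least-squares rotation estimate** of a residual field on the pattern: `lsRot x = (1/8) Σ_u u × x_u` (for a tight twelve-frame,
`Σ_u u × (ω × u) = 8 ω`, so this is the exact rotation content of `x` seen by the gauge). -/
def lsRot (Pat : Finset E3) (x : ↥Pat → E3) : E3 := (1 / 8 : ℝ) • ∑ u : ↥Pat, cross (u : E3) (x u)

section Ledger

variable {Pat : Finset E3}

/-- Sums over a twelve-point pattern. [folklore] -/
theorem sum_le_twelve (hcard : Pat.card = 12) {f : ↥Pat → ℝ} {c : ℝ} (hf : ∀ u, f u ≤ c) :
    ∑ u : ↥Pat, f u ≤ 12 * c := by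
  calc ∑ u : ↥Pat, f u ≤ ∑ _u : ↥Pat, c := Finset.sum_le_sum fun u _ => hf u
    _ = 12 * c := by rw [Finset.sum_const, Finset.card_univ, Fintype.card_coe, hcard, nsmul_eq_mul]; norm_num

/-- `‖Σ_u u × x_u‖ ≤ 12 c` when `‖x_u‖ ≤ c` and the pattern points are unit vectors. [folklore] -/
theorem norm_sum_cross_le (hcard : Pat.card = 12) (h1 : ∀ z ∈ Pat, ‖z‖ = 1) {x : ↥Pat → E3} {c : ℝ}
    (hx : ∀ u, ‖x u‖ ≤ c) : ‖∑ u : ↥Pat, cross (u : E3) (x u)‖ ≤ 12 * c := by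
  refine (norm_sum_le _ _).trans (sum_le_twelve hcard fun u => ?_)
  calc ‖cross (u : E3) (x u)‖ ≤ ‖(u : E3)‖ * ‖x u‖ := norm_cross_le _ _
    _ ≤ c := by rw [h1 u u.2, one_mul]; exact hx u

/-- `‖lsRot x − lsRot x'‖ ≤ (3/2) c` when `‖u × (x_u − x'_u)‖ ≤ c`. [folklore] -/
theorem norm_lsRot_sub_le (hcard : Pat.card = 12) {x x' : ↥Pat → E3} {c : ℝ}
    (hx : ∀ u : ↥Pat, ‖cross (u : E3) (x u - x' u)‖ ≤ c) : ‖lsRot Pat x - lsRot Pat x'‖ ≤ 3 / 2 * c := by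
  have h : lsRot Pat x - lsRot Pat x' = (1 / 8 : ℝ) • ∑ u : ↥Pat, cross (u : E3) (x u - x' u) := by
    simp only [lsRot, cross_sub_right, Finset.sum_sub_distrib, smul_sub]
  rw [h, norm_smul, Real.norm_of_nonneg (by norm_num : (0 : ℝ) ≤ 1 / 8)]
  have := (norm_sum_le _ _).trans (sum_le_twelve hcard hx)
  linarith

/-- **THE GAUGE EQUATION IDENTIFIES THE ROTATION.**  If the residual field `u ↦ d_u + (R u − u) + (R d_u − d_u)` (= `B⁻¹ p_u − u`
with `R = B⁻¹A₀`, `d_u = A₀⁻¹ p_u − u`) is in the least-squares gauge, then `rotVec R = −lsRot d − (1/8) Σ_u u × (R d_u − d_u)`. [folklore] -/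
theorem rotVec_eq_of_gauge (hframe : ∀ z : E3, ∑ u : ↥Pat, ⟪(u : E3), z⟫ • (u : E3) = (4 : ℝ) • z)
    (R : E3 ≃ₗᵢ[ℝ] E3) (d : ↥Pat → E3)
    (hg : ∑ u : ↥Pat, cross (u : E3) (d u + (R u - u) + (R (d u) - d u)) = 0) :
    rotVec R = -lsRot Pat d - (1 / 8 : ℝ) • ∑ u : ↥Pat, cross (u : E3) (R (d u) - d u) := by
  have hRu : ∑ u : ↥Pat, cross (u : E3) (R u - u) = (8 : ℝ) • rotVec R := by
    calc ∑ u : ↥Pat, cross (u : E3) (R u - u)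
        = ∑ u : ↥Pat, (cross (u : E3) (cross (rotVec R) u) + cross (u : E3) (symPart R u)) :=
          Finset.sum_congr rfl fun u _ => by rw [dev_eq, cross_add_right]
      _ = (8 : ℝ) • rotVec R := by
          rw [Finset.sum_add_distrib, sum_cross_cross hframe, sum_cross_symPart hframe, add_zero]
  have hsplit : ∑ u : ↥Pat, cross (u : E3) (d u + (R u - u) + (R (d u) - d u)) =
      ∑ u : ↥Pat, cross (u : E3) (d u) + (8 : ℝ) • rotVec R + ∑ u : ↥Pat, cross (u : E3) (R (d u) - d u) := by
    simp_rw [cross_add_right]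
    rw [Finset.sum_add_distrib, Finset.sum_add_distrib, hRu]
  rw [hsplit] at hg
  apply ext3
  · have hk := congrArg (fun w : E3 => w 0) hg
    simp only [PiLp.add_apply, PiLp.smul_apply, PiLp.zero_apply, smul_eq_mul] at hk
    simp only [lsRot, PiLp.sub_apply, PiLp.neg_apply, PiLp.smul_apply, smul_eq_mul]
    linarith
  · have hk := congrArg (fun w : E3 => w 1) hg
    simp only [PiLp.add_apply, PiLp.smul_apply, PiLp.zero_apply, smul_eq_mul] at hk
    simp only [lsRot, PiLp.sub_apply, PiLp.neg_apply, PiLp.smul_apply, smul_eq_mul]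
    linarith
  · have hk := congrArg (fun w : E3 => w 2) hg
    simp only [PiLp.add_apply, PiLp.smul_apply, PiLp.zero_apply, smul_eq_mul] at hk
    simp only [lsRot, PiLp.sub_apply, PiLp.neg_apply, PiLp.smul_apply, smul_eq_mul]
    linarith

/-- **First-order error of the rotation**: `‖rotVec R + lsRot d‖ ≤ (3/2)·t·a` from an operator bound `‖R v − v‖ ≤ t‖v‖` and
`‖d_u‖ ≤ a`. [folklore] -/
theorem norm_rotVec_add_lsRot_le (hframe : ∀ z : E3, ∑ u : ↥Pat, ⟪(u : E3), z⟫ • (u : E3) = (4 : ℝ) • z)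
    (hcard : Pat.card = 12) (h1 : ∀ z ∈ Pat, ‖z‖ = 1) {R : E3 ≃ₗᵢ[ℝ] E3} {d : ↥Pat → E3} {t a : ℝ}
    (hg : ∑ u : ↥Pat, cross (u : E3) (d u + (R u - u) + (R (d u) - d u)) = 0)
    (hM : ∀ v, ‖R v - v‖ ≤ t * ‖v‖) (hd : ∀ u, ‖d u‖ ≤ a) (ht : 0 ≤ t) :
    ‖rotVec R + lsRot Pat d‖ ≤ 3 / 2 * (t * a) := by
  have hE : ‖∑ u : ↥Pat, cross (u : E3) (R (d u) - d u)‖ ≤ 12 * (t * a) :=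
    norm_sum_cross_le hcard h1 fun u => (hM (d u)).trans (mul_le_mul_of_nonneg_left (hd u) ht)
  have h : rotVec R + lsRot Pat d = -((1 / 8 : ℝ) • ∑ u : ↥Pat, cross (u : E3) (R (d u) - d u)) := by
    rw [rotVec_eq_of_gauge hframe R d hg]; abel
  rw [h, norm_neg, norm_smul, Real.norm_of_nonneg (by norm_num : (0 : ℝ) ≤ 1 / 8)]
  linarith

/-- **BOOTSTRAP STEP**: an operator bound `t` for `R − 1` improves to `‖lsRot d‖ + (3/2) t a + t²/2`. [folklore] -/
theorem dev_bound_step (hframe : ∀ z : E3, ∑ u : ↥Pat, ⟪(u : E3), z⟫ • (u : E3) = (4 : ℝ) • z)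
    (hcard : Pat.card = 12) (h1 : ∀ z ∈ Pat, ‖z‖ = 1) {R : E3 ≃ₗᵢ[ℝ] E3} {d : ↥Pat → E3} {t a : ℝ}
    (hg : ∑ u : ↥Pat, cross (u : E3) (d u + (R u - u) + (R (d u) - d u)) = 0)
    (hM : ∀ v, ‖R v - v‖ ≤ t * ‖v‖) (hd : ∀ u, ‖d u‖ ≤ a) (ht : 0 ≤ t) (v : E3) :
    ‖R v - v‖ ≤ (‖lsRot Pat d‖ + 3 / 2 * (t * a) + t ^ 2 / 2) * ‖v‖ := by
  have hφ : ‖rotVec R‖ ≤ ‖lsRot Pat d‖ + 3 / 2 * (t * a) := by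
    have h := norm_rotVec_add_lsRot_le hframe hcard h1 hg hM hd ht
    calc ‖rotVec R‖ = ‖(rotVec R + lsRot Pat d) - lsRot Pat d‖ := by rw [add_sub_cancel_right]
      _ ≤ ‖rotVec R + lsRot Pat d‖ + ‖lsRot Pat d‖ := norm_sub_le _ _
      _ ≤ _ := by linarith
  rw [dev_eq]
  calc ‖cross (rotVec R) v + symPart R v‖ ≤ ‖cross (rotVec R) v‖ + ‖symPart R v‖ := norm_add_le _ _
    _ ≤ ‖rotVec R‖ * ‖v‖ + t ^ 2 / 2 * ‖v‖ := add_le_add (norm_cross_le _ _) (norm_symPart_le ht hM v)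
    _ ≤ _ := by nlinarith [hφ, norm_nonneg v]

/-- The bootstrap map `t ↦ L + (3/2)·a·t + t²/2` (`L ≥ ‖lsRot d‖`, `a ≥ ‖d_u‖`). -/
def ledgerStep (L a t : ℝ) : ℝ := L + 3 / 2 * (t * a) + t ^ 2 / 2

/-- **BOOTSTRAP, ITERATED**: every iterate of `ledgerStep` from a valid operator bound `t₀` is a valid operator bound. [folklore] -/
theorem dev_bound_iterate (hframe : ∀ z : E3, ∑ u : ↥Pat, ⟪(u : E3), z⟫ • (u : E3) = (4 : ℝ) • z)
    (hcard : Pat.card = 12) (h1 : ∀ z ∈ Pat, ‖z‖ = 1) {R : E3 ≃ₗᵢ[ℝ] E3} {d : ↥Pat → E3} {t₀ a L : ℝ}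
    (hg : ∑ u : ↥Pat, cross (u : E3) (d u + (R u - u) + (R (d u) - d u)) = 0)
    (hd : ∀ u, ‖d u‖ ≤ a) (hL : ‖lsRot Pat d‖ ≤ L) (hM0 : ∀ v, ‖R v - v‖ ≤ t₀ * ‖v‖) (ht₀ : 0 ≤ t₀) (ha : 0 ≤ a) :
    ∀ k : ℕ, 0 ≤ (ledgerStep L a)^[k] t₀ ∧ ∀ v, ‖R v - v‖ ≤ (ledgerStep L a)^[k] t₀ * ‖v‖ := by
  have hL0 : 0 ≤ L := (norm_nonneg _).trans hL
  intro k
  induction k with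
  | zero => exact ⟨ht₀, by simpa using hM0⟩
  | succ k ih =>
    obtain ⟨hk0, hk⟩ := ih
    rw [Function.iterate_succ_apply']
    refine ⟨?_, fun v => ?_⟩
    · have := mul_nonneg hk0 ha
      simp only [ledgerStep]
      nlinarith [sq_nonneg ((ledgerStep L a)^[k] t₀)]
    · refine (dev_bound_step hframe hcard h1 hg hk hd hk0 v).trans (mul_le_mul_of_nonneg_right ?_ (norm_nonneg v))
      simp only [ledgerStep]
      linarith

/-- `ledgerStep` is nonnegative on nonnegative arguments. [folklore] -/
theorem ledgerStep_nonneg {L a t : ℝ} (hL : 0 ≤ L) (ha : 0 ≤ a) (ht : 0 ≤ t) : 0 ≤ ledgerStep L a t := by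
  simp only [ledgerStep]; positivity

/-- `ledgerStep` is monotone on nonnegative arguments. [folklore] -/
theorem ledgerStep_mono {L a s t : ℝ} (ha : 0 ≤ a) (hs : 0 ≤ s) (hst : s ≤ t) : ledgerStep L a s ≤ ledgerStep L a t := by
  simp only [ledgerStep]
  nlinarith [mul_le_mul_of_nonneg_right hst ha, mul_le_mul hst hst hs (hs.trans hst)]

/-- Iterates of `ledgerStep` stay nonnegative. [folklore] -/
theorem iterate_ledgerStep_nonneg {L a t₀ : ℝ} (hL : 0 ≤ L) (ha : 0 ≤ a) (ht₀ : 0 ≤ t₀) :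
    ∀ k : ℕ, 0 ≤ (ledgerStep L a)^[k] t₀ := by
  intro k
  induction k with
  | zero => simpa using ht₀
  | succ k ih => rw [Function.iterate_succ_apply']; exact ledgerStep_nonneg hL ha ih

/-- **Discharging the bootstrap hypothesis by a RATIONAL CHAIN**: if `t₀ ≤ S 0` and `ledgerStep L a (S j) ≤ S (j+1)` for `j < k` then
`ledgerStep^[k] t₀ ≤ S k` — each link is one `norm_num` inequality between small rationals (no iterated squaring). [folklore] -/
theorem iterate_ledgerStep_le_of_chain {L a t₀ : ℝ} (hL : 0 ≤ L) (ha : 0 ≤ a) (ht₀ : 0 ≤ t₀) (S : ℕ → ℝ) (k : ℕ)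
    (h0 : t₀ ≤ S 0) (hS : ∀ j, j < k → ledgerStep L a (S j) ≤ S (j + 1)) : (ledgerStep L a)^[k] t₀ ≤ S k := by
  induction k with
  | zero => simpa using h0
  | succ k ih =>
    rw [Function.iterate_succ_apply']
    have hk := ih fun j hj => hS j (Nat.lt_succ_of_lt hj)
    exact (ledgerStep_mono ha (iterate_ledgerStep_nonneg hL ha ht₀ k) hk).trans (hS k (Nat.lt_succ_self k))

/-- **SHELL RESIDUAL BOUND** (probe `‖n‖ ≤ 1`, pattern point `u`): the full residual `d_u + (R u − u) + (R d_u − d_u)` is the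
de-rotated first-order residual `d_u − (lsRot d) × u` up to `(3/2) t a + t²/2 + t a`. [folklore] -/
theorem inner_res_le (hframe : ∀ z : E3, ∑ u : ↥Pat, ⟪(u : E3), z⟫ • (u : E3) = (4 : ℝ) • z)
    (hcard : Pat.card = 12) (h1 : ∀ z ∈ Pat, ‖z‖ = 1) {R : E3 ≃ₗᵢ[ℝ] E3} {d : ↥Pat → E3} {t a : ℝ}
    (hg : ∑ u : ↥Pat, cross (u : E3) (d u + (R u - u) + (R (d u) - d u)) = 0)
    (hM : ∀ v, ‖R v - v‖ ≤ t * ‖v‖) (hd : ∀ u, ‖d u‖ ≤ a) (ht : 0 ≤ t) {n : E3} (hn : ‖n‖ ≤ 1) (u : ↥Pat) :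
    ⟪n, d u + (R u - u) + (R (d u) - d u)⟫ ≤
      ⟪n, d u - cross (lsRot Pat d) u⟫ + (3 / 2 * (t * a) + t ^ 2 / 2 + t * a) := by
  have hε := norm_rotVec_add_lsRot_le hframe hcard h1 hg hM hd ht
  have hsplit : d u + (R u - u) + (R (d u) - d u) =
      (d u - cross (lsRot Pat d) u) + (cross (rotVec R + lsRot Pat d) u + symPart R u + (R (d u) - d u)) := by
    rw [dev_eq, cross_add_left]; abel
  have hjunk : ‖cross (rotVec R + lsRot Pat d) u + symPart R u + (R (d u) - d u)‖ ≤
      3 / 2 * (t * a) + t ^ 2 / 2 + t * a := by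
    have e1 : ‖cross (rotVec R + lsRot Pat d) (u : E3)‖ ≤ 3 / 2 * (t * a) := by
      calc ‖cross (rotVec R + lsRot Pat d) (u : E3)‖ ≤ ‖rotVec R + lsRot Pat d‖ * ‖(u : E3)‖ := norm_cross_le _ _
        _ = ‖rotVec R + lsRot Pat d‖ := by rw [h1 u u.2, mul_one]
        _ ≤ _ := hε
    have e2 : ‖symPart R u‖ ≤ t ^ 2 / 2 := by
      have := norm_symPart_le ht hM u; rwa [h1 u u.2, mul_one] at this
    have e3 : ‖R (d u) - d u‖ ≤ t * a := (hM _).trans (mul_le_mul_of_nonneg_left (hd u) ht)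
    calc _ ≤ ‖cross (rotVec R + lsRot Pat d) u + symPart R u‖ + ‖R (d u) - d u‖ := norm_add_le _ _
      _ ≤ ‖cross (rotVec R + lsRot Pat d) (u : E3)‖ + ‖symPart R u‖ + ‖R (d u) - d u‖ := by
          gcongr; exact norm_add_le _ _
      _ ≤ _ := by linarith
  rw [hsplit, inner_add_right]
  have : ⟪n, cross (rotVec R + lsRot Pat d) u + symPart R u + (R (d u) - d u)⟫ ≤
      3 / 2 * (t * a) + t ^ 2 / 2 + t * a :=
    calc _ ≤ ‖n‖ * ‖cross (rotVec R + lsRot Pat d) u + symPart R u + (R (d u) - d u)‖ := real_inner_le_norm _ _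
      _ ≤ 1 * (3 / 2 * (t * a) + t ^ 2 / 2 + t * a) := mul_le_mul hn hjunk (norm_nonneg _) (by norm_num)
      _ = _ := one_mul _
  linarith

/-- **CONTACT RESIDUAL BOUND** (probe `‖n‖ ≤ 1`, contact `‖u − w‖ = 1`): the difference of the full residuals is the difference of the
de-rotated first-order residuals up to `(3/2) t a + t²/2 + 2 t a`. [folklore] -/
theorem inner_res_sub_le (hframe : ∀ z : E3, ∑ u : ↥Pat, ⟪(u : E3), z⟫ • (u : E3) = (4 : ℝ) • z)
    (hcard : Pat.card = 12) (h1 : ∀ z ∈ Pat, ‖z‖ = 1) {R : E3 ≃ₗᵢ[ℝ] E3} {d : ↥Pat → E3} {t a : ℝ}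
    (hg : ∑ u : ↥Pat, cross (u : E3) (d u + (R u - u) + (R (d u) - d u)) = 0)
    (hM : ∀ v, ‖R v - v‖ ≤ t * ‖v‖) (hd : ∀ u, ‖d u‖ ≤ a) (ht : 0 ≤ t) {n : E3} (hn : ‖n‖ ≤ 1) {u w : ↥Pat}
    (huw : ‖(u : E3) - w‖ = 1) :
    ⟪n, (d u + (R u - u) + (R (d u) - d u)) - (d w + (R w - w) + (R (d w) - d w))⟫ ≤
      ⟪n, (d u - cross (lsRot Pat d) u) - (d w - cross (lsRot Pat d) w)⟫ + (3 / 2 * (t * a) + t ^ 2 / 2 + 2 * (t * a)) := by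
  have hε := norm_rotVec_add_lsRot_le hframe hcard h1 hg hM hd ht
  have hRuw : (R u - u) - (R w - w) = cross (rotVec R) ((u : E3) - w) + symPart R ((u : E3) - w) := by
    rw [← dev_eq, map_sub]; abel
  have hsplit : (d u + (R u - u) + (R (d u) - d u)) - (d w + (R w - w) + (R (d w) - d w)) =
      ((d u - cross (lsRot Pat d) u) - (d w - cross (lsRot Pat d) w)) +
        (cross (rotVec R + lsRot Pat d) ((u : E3) - w) + symPart R ((u : E3) - w) + ((R (d u) - d u) - (R (d w) - d w))) := by
    have e : (d u + (R u - u) + (R (d u) - d u)) - (d w + (R w - w) + (R (d w) - d w)) =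
        (d u - d w) + ((R u - u) - (R w - w)) + ((R (d u) - d u) - (R (d w) - d w)) := by abel
    rw [e, hRuw]
    simp only [cross_add_left, cross_sub_right]
    abel
  have hjunk : ‖cross (rotVec R + lsRot Pat d) ((u : E3) - w) + symPart R ((u : E3) - w) +
      ((R (d u) - d u) - (R (d w) - d w))‖ ≤ 3 / 2 * (t * a) + t ^ 2 / 2 + 2 * (t * a) := by
    have e1 : ‖cross (rotVec R + lsRot Pat d) ((u : E3) - w)‖ ≤ 3 / 2 * (t * a) := by
      calc ‖cross (rotVec R + lsRot Pat d) ((u : E3) - w)‖ ≤ ‖rotVec R + lsRot Pat d‖ * ‖(u : E3) - w‖ := norm_cross_le _ _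
        _ = ‖rotVec R + lsRot Pat d‖ := by rw [huw, mul_one]
        _ ≤ _ := hε
    have e2 : ‖symPart R ((u : E3) - w)‖ ≤ t ^ 2 / 2 := by
      have := norm_symPart_le ht hM ((u : E3) - w); rwa [huw, mul_one] at this
    have e3 : ‖R (d u) - d u‖ ≤ t * a := (hM _).trans (mul_le_mul_of_nonneg_left (hd u) ht)
    have e4 : ‖R (d w) - d w‖ ≤ t * a := (hM _).trans (mul_le_mul_of_nonneg_left (hd w) ht)
    calc _ ≤ ‖cross (rotVec R + lsRot Pat d) ((u : E3) - w) + symPart R ((u : E3) - w)‖ +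
          ‖(R (d u) - d u) - (R (d w) - d w)‖ := norm_add_le _ _
      _ ≤ ‖cross (rotVec R + lsRot Pat d) ((u : E3) - w)‖ + ‖symPart R ((u : E3) - w)‖ +
          (‖R (d u) - d u‖ + ‖R (d w) - d w‖) := add_le_add (norm_add_le _ _) (norm_sub_le _ _)
      _ ≤ _ := by linarith
  rw [hsplit, inner_add_right]
  have : ⟪n, cross (rotVec R + lsRot Pat d) ((u : E3) - w) + symPart R ((u : E3) - w) +
      ((R (d u) - d u) - (R (d w) - d w))⟫ ≤ 3 / 2 * (t * a) + t ^ 2 / 2 + 2 * (t * a) :=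
    calc _ ≤ ‖n‖ * ‖cross (rotVec R + lsRot Pat d) ((u : E3) - w) + symPart R ((u : E3) - w) +
          ((R (d u) - d u) - (R (d w) - d w))‖ := real_inner_le_norm _ _
      _ ≤ 1 * (3 / 2 * (t * a) + t ^ 2 / 2 + 2 * (t * a)) := mul_le_mul hn hjunk (norm_nonneg _) (by norm_num)
      _ = _ := one_mul _
  linarith

end Ledger

end Summit.AtomisticToContinuum.Crystallization.Theorems.FrustratedLawDichotomyTwoShellRigidityLsLedger
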